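import Mathlib
import HarnessLib
import Literature.Analysis.FluidPDE.AxisymmetricEuler

/-!
# Route `PoloidalWindowDoor`, crux `PoloidalWindowRigidity` (K2, stmt-NavierStokesRegularity-19708) — THICK column, LINES 28 «near_one» / 29 «near_identity»
# (ns-idea-8): the SYMMETRY OBJECTS of the column, VERBATIM — discrete self-similarity and vertical screw-scaling of a backward profile

Seat ns-poloidal-K2-p2 g15 (DIRECTOR-NS #306: idea-crit-7's errand R2 — port the sorry-free kernels of `Cruxes/PoloidalWindowRigidity/Lines/near_one.lean` §26–28
and `…/near_identity.lean` §32–34 into `Theorems/` so that later lines IMPORT them; this file = the four objects, the proof files `…NearOneFloor` /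
`…NearIdentityExtraction` follow).  Definitions only (reviewed); every body is the line file's, token for token.

* `IsDss lam v` — `v` is backward DISCRETELY SELF-SIMILAR with factor `lam` about the space–time origin: `v(t,x) = lam • v(lam²t, lam • x)` for all `t < 0`.
* `IsDssAbout c lam v` — the same about the space–time point `(0, c)`.
* `IsScrew θ lam v` — VERTICAL SCREW-SCALING invariance about the origin: `v(t,x) = lam • R_{−θ} v(lam²t, lam • R_θ x)` for all `t < 0`, `R_θ = rotZ θ` the rotation
  about the vertical (`e₂`, index `2`) axis (`Literature.Analysis.FluidPDE.rotZ`); `θ = 0` is `IsDss lam`.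
* `IsScrewAbout c θ lam v` — the same about the vertical axis through `c` (the translate by `c` is screw-invariant about the origin).

Relation to the Literature vocabulary (not restated here): `Literature.Analysis.FluidPDE.IsDiscretelySelfSimilar c u` (`nsRescale c u = u`, ALL times) and
`IsRotatedDSS c R u` (`c • R.symm (u (c²t) (c • R x)) = u t x`, ALL times, Chae–Wolf 2017 Def. 1.1) are the same laws on the whole time axis; the column's profiles
live on the open past `t < 0` only (Type-I ancient mild class, values at `t ≥ 0` are not data), so the column's objects restrict the law to `t < 0` — a profile that is
`IsDss` need not be `IsDiscretelySelfSimilar` (junk at `t ≥ 0`), which is why the line files carry their own predicates.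

WHAT THIS IS NOT: not a claim about Navier–Stokes regularity — vocabulary for supports of a door route (bears_on LADDER-NS N0, rung N0-LocalTubeDoorPoloidal; crux
19708 / item 20428 OPEN; the research cells of LINES 28/29 OPEN; NS regularity NOT proved).
-/

noncomputable section

-- the summit and its single sub-problem share the name (CONVENTIONS §1), as in every Theorems file
set_option linter.dupNamespace false

namespace Summit.NavierStokesRegularity.NavierStokesRegularity.Theorems.PoloidalWindowDoorPoloidalWindowRigidityNearIdentityDefs

open Literature.Analysis Literature.Analysis.FluidPDE

/-- **`IsDss lam v`** — `v` is backward DISCRETELY SELF-SIMILAR with factor `lam` about the space–time origin (the blow-up point of the column):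
`v(t,x) = lam • v(lam² t, lam • x)` for every `t < 0` and `x` (LINE 28 «near_one» §26, VERBATIM; Tsai 2014 / Chae–Wolf 2017 Def. 1.1 restricted to the open past). -/
def IsDss (lam : ℝ) (v : ℝ → EuclideanSpace ℝ (Fin 3) → EuclideanSpace ℝ (Fin 3)) : Prop :=
  ∀ t < 0, ∀ x, v t x = lam • v (lam ^ 2 * t) (lam • x)

/-- **`IsDssAbout c lam v`** — DSS with factor `lam` about the space–time point `(0, c)`: `v(t,x) = lam • v(lam² t, c + lam • (x − c))` for every `t < 0`
(LINE 28 «near_one» §26, VERBATIM). -/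
def IsDssAbout (c : EuclideanSpace ℝ (Fin 3)) (lam : ℝ) (v : ℝ → EuclideanSpace ℝ (Fin 3) → EuclideanSpace ℝ (Fin 3)) : Prop :=
  ∀ t < 0, ∀ x, v t x = lam • v (lam ^ 2 * t) (c + lam • (x - c))

/-- **`IsScrew θ lam v`** — VERTICAL SCREW-SCALING invariance about the origin: `v(t,x) = lam • R_{−θ} v(lam² t, lam • R_θ x)` for all `t < 0` — the NS symmetry
`u ↦ lam Qᵀ u(lam²·, lam Q ·)` with `Q = R_θ = rotZ θ` the rotation by `θ` about the vertical (`e₂`, index `2`) axis; `θ = 0` is `IsDss lam`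
(LINE 29 «near_identity» §32, VERBATIM). -/
def IsScrew (θ lam : ℝ) (v : ℝ → EuclideanSpace ℝ (Fin 3) → EuclideanSpace ℝ (Fin 3)) : Prop :=
  ∀ t < 0, ∀ x, v t x = lam • rotZ (-θ) (v (lam ^ 2 * t) (lam • rotZ θ x))

/-- **`IsScrewAbout c θ lam v`** — screw-scaling invariance about the vertical axis through the centre `c`: the translate `x ↦ v(t, x + c)` is screw-invariant
about the origin (LINE 29 «near_identity» §32, VERBATIM). -/
def IsScrewAbout (c : EuclideanSpace ℝ (Fin 3)) (θ lam : ℝ) (v : ℝ → EuclideanSpace ℝ (Fin 3) → EuclideanSpace ℝ (Fin 3)) : Prop :=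
  IsScrew θ lam (fun t x => v t (x + c))

end Summit.NavierStokesRegularity.NavierStokesRegularity.Theorems.PoloidalWindowDoorPoloidalWindowRigidityNearIdentityDefs

end
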